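import Literature.MathematicalPhysics.QuantumLattice.WightmanEuclidSort
import Literature.MathematicalPhysics.QuantumLattice.WightmanPermutedTubeLocal
import Literature.MathematicalPhysics.QuantumLattice.WightmanLocality
import HarnessLib

/-!
# Consistency of the continued Wightman function at Euclidean points under re-sorting (`d ≥ 2`)

Topic `Literature/MathematicalPhysics/QuantumLattice` (trunk T-AQFT). The local-to-Euclidean step
in the symmetry of the Schwinger functions (`IsWickRotationOf.schwinger_symmetric`;
Osterwalder–Schrader I (1973), §5 p. 97: the continued Wightman function is "single valued,
symmetric" on `S'ₙ ⊇ Sₙ`; Streater–Wightman (1964), Thm. 3-6), proved here **at the Euclidean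
points in space dimension `d ≥ 2` without any global statement about the permuted extended tube**:

* `perm_eSort_eq_nhds` (**key lemma**): let `𝔚` be analytic on the extended relative tube `𝒯'ₙ`,
  `L₊(ℂ)`-invariant, with a local distributional boundary value (`IsLocalDistribution`,
  Streater–Wightman Thm. 3-2 (d)). For an injective Euclidean configuration `x` and all `x'` near
  `x`, `𝔚(e(x') ∘ eSort x') = 𝔚(e(x') ∘ eSort x)` (`e = euclideanPoint`, `eSort` the lexicographic
  sorting permutation of `WightmanEuclidSort`).

Proof. With `τ = eSort x'`, `π = eSort x`, the directions `u = u_ε` and `u' = u_{ε'}`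
(`WightmanEuclidSort`) certify `τ` for `x'` and `π` for every configuration near `x`; the
certificate sets are convex and certify membership of the permuted Euclidean points in `𝒯'ₙ`. The
real, time-zero configuration `r_i = rank_τ(i) c + rank_π(i) c'`, with spatial `c, c'` dual to
`(u, u')` — this is where `d ≥ 2` and `ε ≠ ε'` enter — lies in both certificate sets, so the
segment from `x'` to `r` does, and its image `U = {e(y) ∘ π}` is a preconnected subset of
`𝒯'ₙ ∩ (πτ⁻¹)𝒯'ₙ` joining `e(x') ∘ π` to the real Jost point `r ∘ π`. Streater–Wightman's
Thm. 3-6 at that real point (`perm_eq_nhds_of_real`, `WightmanPermutedTubeLocal`) propagates along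
`U` by the identity theorem (`perm_eq_on_preconnected`). In `d = 1` the two spatial directions do
not exist (indeed there `𝒯'₃ ∩ σ𝒯'₃` has no real points), and the lemma is not claimed.

## References

* K. Osterwalder, R. Schrader, Comm. Math. Phys. 31 (1973), §5 p. 97. [OsterwalderSchraderCMP1973]
* R. F. Streater, A. S. Wightman, *PCT, Spin and Statistics, and All That* (1964), Thm. 3-6,
  §2-4 Fig. 2-4. [StreaterWightman1964]

## Tree

`perm_eq_on_preconnected`, `IsLocalDistribution` (`WightmanPermutedTubeLocal`, `WightmanLocality`),
`eSort`, `certSet`, `uPow`, `eventually_strictMono_inner_uPow_eSort`,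
`eventually_strictMono_inner_nhds`, `euclideanPoint_perm_mem_relExtendedTube_of_mem_certSet`
(`WightmanEuclidSort`), `complexifyPoint_eq_euclideanPoint_of_time_zero`
(`WightmanAnalyticContinuation`).
-/

noncomputable section

open Filter Set
open _root_.Topology
open scoped RealInnerProductSpace

namespace Literature.MathematicalPhysics.QuantumLattice

variable {d n : ℕ}

/-! ### Injectivity is an open condition -/

/-- Injective configurations form an open set: a configuration near an injective one is
injective. [folklore] -/
theorem eventually_injective_nhds {X : Type*} [TopologicalSpace X] [T2Space X]
    {x : Fin n → X} (hx : Function.Injective x) :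
    ∀ᶠ x' in 𝓝 x, Function.Injective x' := by
  have hpair : ∀ p : Fin n × Fin n, ∀ᶠ x' in 𝓝 x, p.1 ≠ p.2 → x' p.1 ≠ x' p.2 := by
    rintro ⟨k, l⟩
    by_cases hkl : k = l
    · exact Eventually.of_forall fun x' h => absurd hkl h
    · have hO : IsOpen {x' : Fin n → X | x' k ≠ x' l} :=
        isOpen_compl_iff.2 (isClosed_eq (continuous_apply k) (continuous_apply l))
      filter_upwards [hO.mem_nhds (show x k ≠ x l from fun h => hkl (hx h))] with x' hx' _
      exact hx'
  filter_upwards [(eventually_all).2 hpair] with x' hx'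
  intro k l hkl
  by_contra h
  exact hx' (k, l) h hkl

/-! ### The common real configuration -/

section RealConfig

variable {m : ℕ}

/-- The spatial vector `c` with `⟪u_ε, c⟫ = 1`, `⟪u_{ε'}, c⟫ = 0` (coordinates `1` and `2`;
space dimension `≥ 2`). [folklore] -/
def dualVec (ε ε' : ℝ) : EuclideanSpace ℝ (Fin (m + 2 + 1)) :=
  EuclideanSpace.single 1 (ε' / (ε * (ε' - ε))) + EuclideanSpace.single 2 (-1 / (ε * (ε' - ε)))

/-- `0 ≠ 1` and `0 ≠ 2` in `Fin (m + 3)`. [folklore] -/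
theorem fin_zero_ne_one_two : (0 : Fin (m + 2 + 1)) ≠ 1 ∧ (0 : Fin (m + 2 + 1)) ≠ 2 := by
  refine ⟨fun h => ?_, fun h => ?_⟩
  · have := congr_arg Fin.val h
    rw [Fin.val_zero, Fin.val_one] at this
    exact absurd this (by norm_num)
  · have := congr_arg Fin.val h
    rw [Fin.val_zero, Fin.val_two] at this
    exact absurd this (by norm_num)

/-- The time component of `dualVec` vanishes. [folklore] -/
theorem dualVec_apply_zero (ε ε' : ℝ) : (dualVec ε ε' : EuclideanSpace ℝ (Fin (m + 2 + 1))) 0 = 0 := by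
  obtain ⟨h01, h02⟩ := fin_zero_ne_one_two (m := m)
  simp [dualVec, h01, h02]

/-- `⟪u_δ, single i a⟫ = δ^i a`. [folklore] -/
theorem inner_uPow_single (δ : ℝ) (i : Fin (m + 2 + 1)) (a : ℝ) :
    ⟪uPow (m + 2) δ, EuclideanSpace.single i a⟫ = δ ^ (i : ℕ) * a := by
  rw [inner_uPow, Finset.sum_eq_single i]
  · simp
  · intro b _ hb; simp [hb]
  · simp

/-- `⟪u_δ, dualVec ε ε'⟫ = δ ε'/(ε(ε'−ε)) − δ²/(ε(ε'−ε))`. [folklore] -/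
theorem inner_uPow_dualVec (δ ε ε' : ℝ) :
    ⟪uPow (m + 2) δ, (dualVec ε ε' : EuclideanSpace ℝ (Fin (m + 2 + 1)))⟫ =
      δ * (ε' / (ε * (ε' - ε))) + δ ^ 2 * (-1 / (ε * (ε' - ε))) := by
  have h1 : ((1 : Fin (m + 2 + 1)) : ℕ) = 1 := Fin.val_one _
  have h2 : ((2 : Fin (m + 2 + 1)) : ℕ) = 2 := Fin.val_two
  rw [dualVec, inner_add_right, inner_uPow_single, inner_uPow_single, h1, h2, pow_one]

/-- `⟪u_ε, dualVec ε ε'⟫ = 1`. [folklore] -/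
theorem inner_uPow_dualVec_self {ε ε' : ℝ} (hε : ε ≠ 0) (hne : ε' - ε ≠ 0) :
    ⟪uPow (m + 2) ε, (dualVec ε ε' : EuclideanSpace ℝ (Fin (m + 2 + 1)))⟫ = 1 := by
  rw [inner_uPow_dualVec]
  field_simp
  ring

/-- `⟪u_{ε'}, dualVec ε ε'⟫ = 0`. [folklore] -/
theorem inner_uPow_dualVec_other {ε ε' : ℝ} (hε : ε ≠ 0) (hne : ε' - ε ≠ 0) :
    ⟪uPow (m + 2) ε', (dualVec ε ε' : EuclideanSpace ℝ (Fin (m + 2 + 1)))⟫ = 0 := by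
  rw [inner_uPow_dualVec]
  field_simp
  ring

/-- **The common real configuration** of two orderings `τ, π` and two parameters `ε ≠ ε'`:
`r_i = rank_τ(i) c + rank_π(i) c'` with `c = dualVec ε ε'`, `c' = dualVec ε' ε` (spatial, time
zero). Along `τ` its `u_ε`-heights are `0, 1, 2, …`, along `π` its `u_{ε'}`-heights are
`0, 1, 2, …`. [folklore] -/
def commonConfig (τ π : Equiv.Perm (Fin n)) (ε ε' : ℝ) : Fin n → EuclideanSpace ℝ (Fin (m + 2 + 1)) :=
  fun i => ((τ.symm i : ℕ) : ℝ) • dualVec ε ε' + ((π.symm i : ℕ) : ℝ) • dualVec ε' ε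

/-- The common configuration has time zero. [folklore] -/
theorem commonConfig_apply_zero (τ π : Equiv.Perm (Fin n)) (ε ε' : ℝ) (i : Fin n) :
    (commonConfig τ π ε ε' i : EuclideanSpace ℝ (Fin (m + 2 + 1))) 0 = 0 := by
  simp [commonConfig, dualVec_apply_zero]

/-- Heights of the common configuration along `τ`: `⟪u_ε, r_{τ(k)}⟫ = k`. [folklore] -/
theorem inner_uPow_commonConfig_left (τ π : Equiv.Perm (Fin n)) {ε ε' : ℝ} (hε : ε ≠ 0)
    (hε' : ε' ≠ 0) (hne : ε ≠ ε') (k : Fin n) :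
    ⟪uPow (m + 2) ε, (commonConfig τ π ε ε' (τ k) : EuclideanSpace ℝ (Fin (m + 2 + 1)))⟫ = (k : ℕ) := by
  have h1 : ε' - ε ≠ 0 := sub_ne_zero.2 (Ne.symm hne)
  have h2 : ε - ε' ≠ 0 := sub_ne_zero.2 hne
  rw [commonConfig, inner_add_right, inner_smul_right, inner_smul_right,
    inner_uPow_dualVec_self hε h1, inner_uPow_dualVec_other hε' h2]
  simp

/-- Heights of the common configuration along `π`: `⟪u_{ε'}, r_{π(k)}⟫ = k`. [folklore] -/
theorem inner_uPow_commonConfig_right (τ π : Equiv.Perm (Fin n)) {ε ε' : ℝ} (hε : ε ≠ 0)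
    (hε' : ε' ≠ 0) (hne : ε ≠ ε') (k : Fin n) :
    ⟪uPow (m + 2) ε', (commonConfig τ π ε ε' (π k) : EuclideanSpace ℝ (Fin (m + 2 + 1)))⟫ = (k : ℕ) := by
  have h1 : ε' - ε ≠ 0 := sub_ne_zero.2 (Ne.symm hne)
  have h2 : ε - ε' ≠ 0 := sub_ne_zero.2 hne
  rw [commonConfig, inner_add_right, inner_smul_right, inner_smul_right,
    inner_uPow_dualVec_other hε h1, inner_uPow_dualVec_self hε' h2]
  simp

/-- The common configuration lies in both certificate sets. [folklore] -/
theorem commonConfig_mem_certSet (τ π : Equiv.Perm (Fin n)) {ε ε' : ℝ} (hε : ε ≠ 0)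
    (hε' : ε' ≠ 0) (hne : ε ≠ ε') :
    (commonConfig τ π ε ε' : Fin n → EuclideanSpace ℝ (Fin (m + 2 + 1))) ∈ certSet n τ (uPow (m + 2) ε) ∧
    (commonConfig τ π ε ε' : Fin n → EuclideanSpace ℝ (Fin (m + 2 + 1))) ∈ certSet n π (uPow (m + 2) ε') := by
  constructor
  · intro k l hkl
    simp only [inner_uPow_commonConfig_left τ π hε hε' hne]
    exact Nat.cast_lt.2 (Fin.lt_def.1 hkl)
  · intro k l hkl
    simp only [inner_uPow_commonConfig_right τ π hε hε' hne]
    exact Nat.cast_lt.2 (Fin.lt_def.1 hkl)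

end RealConfig

/-! ### The key lemma -/

/-- **Consistency of the continued Wightman function at Euclidean points under re-sorting**
(space dimension `d = m + 2 ≥ 2`). Let `𝔚` be analytic on the extended relative tube, invariant
under `L₊(ℂ)`, with a local distributional boundary value `T` (adjacent-swap locality on
space-like supports, Streater–Wightman Thm. 3-2 (d)). Then for every injective Euclidean
configuration `x`, for all `x'` near `x`, the values of `𝔚` at the Euclidean point of `x'` sorted
by its own lexicographic order and sorted by the lexicographic order of `x` agree. This is the
Euclidean instance of "`W` and `W_π` continue one another" (Streater–Wightman Thm. 3-6) /
"single valued, symmetric on `S'ₙ ⊇ Sₙ`" (OS I §5 p. 97) that the symmetry of the Schwinger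
functions needs; the overlap geometry is handled by convex linear certificates and one common real
Jost point. [cite: OsterwalderSchraderCMP1973, §5 p. 97] -/
theorem perm_eSort_eq_nhds {m : ℕ} {𝔚 : (Fin n → Fin (m + 2 + 1) → ℂ) → ℂ}
    {T : SchwartzMap (Fin n → SpaceTime (m + 2)) ℂ →L[ℂ] ℂ}
    (h𝔚 : AnalyticOnNhd ℂ 𝔚 (relExtendedTube (m + 2) n))
    (hbv : HasDistributionalBoundaryValue 𝔚 T) (hloc : IsLocalDistribution (m + 2) n T)
    (hinv : ∀ Λ ∈ properComplexLorentzGroup (m + 2), ∀ z ∈ relExtendedTube (m + 2) n,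
      𝔚 (fun i => Λ (z i)) = 𝔚 z)
    {x : Fin n → EuclideanSpace ℝ (Fin (m + 2 + 1))} (hx : Function.Injective x) :
    ∀ᶠ x' in 𝓝 x, 𝔚 (fun k => euclideanPoint x' (eSort x' k)) =
      𝔚 (fun k => euclideanPoint x' (eSort x k)) := by
  -- the certificate of `π = eSort x` for all configurations near `x`
  set π : Equiv.Perm (Fin n) := eSort x with hπ
  obtain ⟨ε', hε'pos, hε'⟩ : ∃ ε' : ℝ, 0 < ε' ∧ StrictMono fun k => ⟪uPow (m + 2) ε', x (π k)⟫ := by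
    obtain ⟨ε', h1, h2⟩ := ((eventually_strictMono_inner_uPow_eSort hx).and self_mem_nhdsWithin).exists
    exact ⟨ε', h2, h1⟩
  have hN := eventually_strictMono_inner_nhds (σ := π) hε'
  filter_upwards [hN, eventually_injective_nhds hx] with x' hx'π hx'inj
  -- the certificate of `τ = eSort x'` for `x'`, with a parameter `ε < ε'`
  set τ : Equiv.Perm (Fin n) := eSort x' with hτ
  obtain ⟨ε, hεpos, hεlt, hε⟩ : ∃ ε : ℝ, 0 < ε ∧ ε < ε' ∧
      StrictMono fun k => ⟪uPow (m + 2) ε, x' (τ k)⟫ := by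
    have hev : ∀ᶠ ε in 𝓝[>] (0 : ℝ), ε < ε' := nhdsWithin_le_nhds (Iio_mem_nhds hε'pos)
    obtain ⟨ε, ⟨h1, h2⟩, h3⟩ :=
      (((eventually_strictMono_inner_uPow_eSort hx'inj).and hev).and self_mem_nhdsWithin).exists
    exact ⟨ε, h3, h2, h1⟩
  have hne : ε ≠ ε' := hεlt.ne
  set u : EuclideanSpace ℝ (Fin (m + 2 + 1)) := uPow (m + 2) ε with hu
  set u' : EuclideanSpace ℝ (Fin (m + 2 + 1)) := uPow (m + 2) ε' with hu'
  have hu0 : u ≠ 0 := uPow_ne_zero ε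
  have hu'0 : u' ≠ 0 := uPow_ne_zero ε'
  -- the common real configuration and the segment
  set r : Fin n → EuclideanSpace ℝ (Fin (m + 2 + 1)) := commonConfig τ π ε ε' with hr
  obtain ⟨hrτ, hrπ⟩ := commonConfig_mem_certSet (m := m) τ π hεpos.ne' hε'pos.ne' hne
  have hx'τ : x' ∈ certSet n τ u := hε
  have hx'π' : x' ∈ certSet n π u' := hx'π
  set y : ℝ → Fin n → EuclideanSpace ℝ (Fin (m + 2 + 1)) := fun s => (1 - s) • x' + s • r with hy
  have hyτ : ∀ s ∈ Icc (0 : ℝ) 1, y s ∈ certSet n τ u := fun s hs =>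
    convex_certSet τ u hx'τ hrτ (by linarith [hs.2]) hs.1 (by ring)
  have hyπ : ∀ s ∈ Icc (0 : ℝ) 1, y s ∈ certSet n π u' := fun s hs =>
    convex_certSet π u' hx'π' hrπ (by linarith [hs.2]) hs.1 (by ring)
  -- the preconnected set `U = {e(y s) ∘ π}`
  set Φ : ℝ → Fin n → Fin (m + 2 + 1) → ℂ := fun s => fun k => euclideanPoint (y s) (π k) with hΦ
  have hΦc : Continuous Φ := by
    have hyc : Continuous y := by fun_prop
    have h1 : Continuous fun s => euclideanPoint (y s) :=
      (euclideanPointCLM (m + 2) n).continuous.comp hyc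
    exact continuous_pi fun k => (continuous_apply (π k)).comp h1
  set U : Set (Fin n → Fin (m + 2 + 1) → ℂ) := Φ '' Icc 0 1 with hU
  have hUpre : IsPreconnected U := (isPreconnected_Icc).image Φ hΦc.continuousOn
  have hUE : U ⊆ relExtendedTube (m + 2) n := by
    rintro _ ⟨s, hs, rfl⟩
    exact euclideanPoint_perm_mem_relExtendedTube_of_mem_certSet hu'0 (hyπ s hs)
  set σ : Equiv.Perm (Fin n) := π⁻¹ * τ with hσ
  have hπσ : ∀ k, π (σ k) = τ k := fun k => by simp [hσ]
  have hUσ : ∀ z ∈ U, (fun k => z (σ k)) ∈ relExtendedTube (m + 2) n := by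
    rintro _ ⟨s, hs, rfl⟩
    have := euclideanPoint_perm_mem_relExtendedTube_of_mem_certSet hu0 (hyτ s hs)
    simpa only [hΦ, hπσ] using this
  -- the real point `r ∘ π`
  have hgen : ∀ ρ : Equiv.Perm (Fin n),
      (fun k => complexifyPoint ((r ∘ ρ) k)) = fun k => euclideanPoint r (ρ k) := fun ρ =>
    (complexifyPoint_eq_euclideanPoint_of_time_zero (y := r ∘ ρ) fun k =>
      commonConfig_apply_zero τ π ε ε' (ρ k)).trans (euclideanPoint_comp_perm r ρ)
  have hy1 : y 1 = r := by simp [hy]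
  have hrU : (fun k => complexifyPoint ((r ∘ π) k)) ∈ U := by
    rw [hgen π]
    exact ⟨1, ⟨zero_le_one, le_rfl⟩, by simp [hΦ, hy1]⟩
  have hrE : (fun k => complexifyPoint ((r ∘ π) k)) ∈ relExtendedTube (m + 2) n := hUE hrU
  have hrσE : (fun k => complexifyPoint ((r ∘ π) (σ k))) ∈ relExtendedTube (m + 2) n := by
    have h1 : (fun k => complexifyPoint ((r ∘ π) (σ k))) = fun k => complexifyPoint ((r ∘ τ) k) := by
      funext k; simp only [Function.comp_apply, hπσ]
    rw [h1, hgen τ]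
    exact euclideanPoint_perm_mem_relExtendedTube_of_mem_certSet hu0 hrτ
  -- Streater–Wightman Thm. 3-6 at `r ∘ π`, propagated along `U`
  have hkey := perm_eq_on_preconnected h𝔚 hbv hloc hinv σ hUpre hUE hUσ hrE hrσE
    (Subgroup.one_mem _) (by simpa using hrU)
  -- evaluate at `s = 0`
  have hy0 : y 0 = x' := by simp [hy]
  have h0U : (fun k => euclideanPoint x' (π k)) ∈ U :=
    ⟨0, ⟨le_rfl, zero_le_one⟩, by simp [hΦ, hy0]⟩
  have := hkey _ h0U
  simpa only [hπσ] using this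

end Literature.MathematicalPhysics.QuantumLattice
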